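import Literature.MathematicalPhysics.QuantumManyBody.PeriodicBoseGasScatteringProfile
import Mathlib.Analysis.ODE.ExistUnique
import Mathlib.Analysis.SpecialFunctions.Trigonometric.DerivHyp
import HarnessLib

/-!
# The scattering length of the finite spherical well: `a = R - tanh(R√(K/2))/√(K/2)`

Topic `Literature/MathematicalPhysics/QuantumManyBody`, namespace `BoseGas` (provefact
`Literature.MathematicalPhysics.QuantumManyBody.BoseGas.Junge2026_neumannBox_pinnedLowerBound`; the
explicit input of [FournaisEtAl2024, Lemma 3.3] in the replacement of a hard-core potential by an
integrable one, Prop. 2.1). For the finite well of height `K > 0` and radius `R` — radial profile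
`w = K·1_{r ≤ R}`, units `ħ = 2m = 1`, scattering equation `-Δφ + ½wφ = 0` as everywhere in the
topic — the zero-energy radial solution of `LSSY2005, (2.4)` is
`u(r) = sinh(cr)/c`, `u'(r) = cosh(cr)`, `c = √(K/2)`, on `[0, R]` ("one can compute `a_K` by
solving `-Δφ + ½K1_{B(0,R_K)}φ = 0`, to find `φ(x) = c sinh(√(K/2)|x|)/|x|` for `|x| ≤ R_K`"
[FournaisEtAl2024, (3.8)]), whence the scattering length
`a = R - u(R)/u'(R) = R - tanh(cR)/c` [FournaisEtAl2024, (3.9), in the form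
`R_K - a_K = (1-e^{-2γ})/(γ - 1 + e^{-2γ}(γ+1)) a_K`, `γ = cR`] and the bound used there,
`0 ≤ R - a ≤ √(2/K)` (`tanh ≤ 1`; the paper states `≤ 2√2/√K`).

* `radialSol_squareWell`, `radialSolDeriv_squareWell` — the radial solution and its derivative on
  `[0, R]`, by ODE uniqueness (`ODE_solution_unique_of_mem_Icc_right` for the system
  `(u, u')' = (u', ½Ku)`, the tree's Volterra solution `radialSol`, `radialSolDeriv` of
  `PeriodicBoseGasScatteringODE*.lean` being one solution and `(sinh(cr)/c, cosh(cr))` the other);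
* `odeScatteringLength_squareWell` — `a_ODE = R - tanh(cR)/c`;
* `scatteringLength_squareWell` — **the variational scattering length of the well is
  `R - tanh(R√(K/2))/√(K/2)`** (`scatteringLength_eq_ofReal_odeScatteringLength`, LSSY Thm. C.1);
* `sub_scatteringLength_squareWell_le` — `R - a ≤ √(2/K)`, and `a ≤ R`.

No definitions (the well is `(Set.Iic R).indicator (fun _ => ENNReal.ofReal K)`).

## References

* [FournaisEtAl2024] S. Fournais, L. Junge, T. Girardot, L. Morin, M. Olivieri, A. Triay, *The free
  energy of dilute Bose gases at low temperatures interacting via strong potentials*,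
  arXiv:2408.14222, Ann. Henri Poincaré (2026): Lemma 3.3, (3.8)–(3.9).
* [LSSY2005] E. H. Lieb, R. Seiringer, J. P. Solovej, J. Yngvason, *The Mathematics of the Bose Gas
  and its Condensation*, Birkhäuser 2005: (2.4)–(2.5), App. C Thm. C.1.
-/

noncomputable section

open MeasureTheory Set Filter Topology
open scoped ENNReal NNReal

namespace Literature.MathematicalPhysics.QuantumManyBody.BoseGas

/-! ### The well `w = K·1_{r ≤ R}` -/

/-- The well is measurable. [folklore] -/
theorem measurable_squareWell (K R : ℝ) :
    Measurable ((Set.Iic R).indicator fun _ : ℝ => ENNReal.ofReal K) :=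
  measurable_const.indicator measurableSet_Iic

/-- The well is bounded by `K`. [folklore] -/
theorem squareWell_le (K R r : ℝ) :
    (Set.Iic R).indicator (fun _ : ℝ => ENNReal.ofReal K) r ≤ ENNReal.ofReal K := by
  by_cases h : r ∈ Set.Iic R
  · rw [Set.indicator_of_mem h]
  · rw [Set.indicator_of_notMem h]; exact zero_le

/-- The well vanishes beyond `R`. [folklore] -/
theorem squareWell_eq_zero {K R s : ℝ} (hs : R < s) :
    (Set.Iic R).indicator (fun _ : ℝ => ENNReal.ofReal K) s = 0 :=
  Set.indicator_of_notMem (by simpa using hs) _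

/-- Inside, the well equals `K`. [folklore] -/
theorem squareWell_toReal_of_le {K R s : ℝ} (hK : 0 ≤ K) (hs : s ≤ R) :
    ((Set.Iic R).indicator (fun _ : ℝ => ENNReal.ofReal K) s).toReal = K := by
  rw [Set.indicator_of_mem (show s ∈ Set.Iic R from hs), ENNReal.toReal_ofReal hK]

/-! ### The radial solution of the well on `[0, R]` -/

section Well

variable {K R : ℝ}

/-- For the well, `u` is continuous on all of `ℝ` (it vanishes on `(-∞, 0]` and is the primitive
of the continuous `u'` on `[0, ∞)`). [cite: LSSY2005, (2.4)–(2.5)] -/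
theorem continuous_radialSol_squareWell (hK : 0 ≤ K) :
    Continuous (radialSol ((Set.Iic R).indicator fun _ : ℝ => ENNReal.ofReal K)) := by
  set w : ℝ → ℝ≥0∞ := (Set.Iic R).indicator fun _ : ℝ => ENNReal.ofReal K with hw_def
  have hw : Measurable w := measurable_squareWell K R
  have hwM : ∀ r, w r ≤ ENNReal.ofReal K := squareWell_le K R
  have hc := continuous_radialSolDeriv hw hwM hK
  -- the primitive `P r = ∫₀^r u'`
  have hP : ∀ r, HasDerivAt (fun r => ∫ s in (0 : ℝ)..r, radialSolDeriv w s) (radialSolDeriv w r) r :=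
    fun r => intervalIntegral.integral_hasDerivAt_right (hc.intervalIntegrable 0 r)
      (hc.stronglyMeasurableAtFilter _ _) hc.continuousAt
  have hPc : Continuous fun r => ∫ s in (0 : ℝ)..r, radialSolDeriv w s :=
    continuous_iff_continuousAt.2 fun r => (hP r).continuousAt
  refine continuous_iff_continuousAt.2 fun r => ?_
  rcases lt_trichotomy r 0 with hr | hr | hr
  · -- `u = 0` near `r < 0`
    refine (continuousAt_const (y := (0 : ℝ))).congr ?_
    filter_upwards [Iio_mem_nhds hr] with s hs
    exact (radialSol_of_nonpos w (le_of_lt hs)).symm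
  · -- at `0`: squeeze between `0` and the primitive
    subst hr
    rw [ContinuousAt, radialSol_of_nonpos w le_rfl]
    have hP0 : Tendsto (fun r => ∫ s in (0 : ℝ)..r, radialSolDeriv w s) (𝓝 0) (𝓝 0) := by
      have := hPc.continuousAt (x := 0)
      rwa [ContinuousAt, intervalIntegral.integral_same] at this
    have hP0abs : Tendsto (fun r => |∫ s in (0 : ℝ)..r, radialSolDeriv w s|) (𝓝 0) (𝓝 0) := by
      simpa using hP0.abs
    refine tendsto_of_tendsto_of_tendsto_of_le_of_le' tendsto_const_nhds hP0abs ?_ ?_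
    · exact Eventually.of_forall fun r => radialSol_nonneg w r
    · filter_upwards with r
      rcases le_or_gt r 0 with h | h
      · rw [radialSol_of_nonpos w h]; exact abs_nonneg _
      · rw [radialSol_eq_intervalIntegral_deriv hw hwM hK h.le]; exact le_abs_self _
  · exact continuousAt_radialSol hw hwM hK hr

/-- **The zero-energy radial solution of the finite well is `u(r) = sinh(cr)/c`, `u'(r) = cosh(cr)`,
`c = √(K/2)`, on `[0, R]`** (`K > 0`): both `(u, u')` and `(sinh(cr)/c, cosh(cr))` solve
`(x, y)' = (y, ½Kx)` on `[0, R]` with the same value `(0, 1)` at `r = 0`.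
[cite: FournaisEtAl2024, (3.8)] -/
theorem radialSol_radialSolDeriv_squareWell (hK : 0 < K) (hR : 0 ≤ R) {r : ℝ} (hr0 : 0 ≤ r)
    (hrR : r ≤ R) :
    radialSol ((Set.Iic R).indicator fun _ : ℝ => ENNReal.ofReal K) r =
        Real.sinh (Real.sqrt (K / 2) * r) / Real.sqrt (K / 2) ∧
      radialSolDeriv ((Set.Iic R).indicator fun _ : ℝ => ENNReal.ofReal K) r =
        Real.cosh (Real.sqrt (K / 2) * r) := by
  set w : ℝ → ℝ≥0∞ := (Set.Iic R).indicator fun _ : ℝ => ENNReal.ofReal K with hw_def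
  set c : ℝ := Real.sqrt (K / 2) with hc_def
  have hc0 : 0 < c := Real.sqrt_pos.2 (by positivity)
  have hc2 : c ^ 2 = K / 2 := Real.sq_sqrt (by positivity)
  have hw : Measurable w := measurable_squareWell K R
  have hwM : ∀ r, w r ≤ ENNReal.ofReal K := squareWell_le K R
  have hK0 : 0 ≤ K := hK.le
  have hucont : Continuous (radialSol w) := continuous_radialSol_squareWell (R := R) hK0
  have hu'cont : Continuous (radialSolDeriv w) := continuous_radialSolDeriv hw hwM hK0
  -- the vector field and its Lipschitz constant
  set L : ℝ × ℝ →L[ℝ] ℝ × ℝ :=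
    (ContinuousLinearMap.snd ℝ ℝ ℝ).prod ((K / 2) • ContinuousLinearMap.fst ℝ ℝ ℝ) with hL
  have hLapply : ∀ p : ℝ × ℝ, L p = (p.2, K / 2 * p.1) := fun p => by
    simp [hL, smul_eq_mul]
  set v : ℝ → ℝ × ℝ → ℝ × ℝ := fun _ p => (p.2, K / 2 * p.1) with hv
  have hvL : ∀ t, LipschitzOnWith ‖L‖₊ (v t) univ := fun t => by
    have h1 : v t = fun p => L p := by funext p; rw [hLapply]
    rw [h1]
    exact L.lipschitz.lipschitzOnWith
  -- the two trajectories
  set f : ℝ → ℝ × ℝ := fun t => (radialSol w t, radialSolDeriv w t) with hf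
  set g : ℝ → ℝ × ℝ := fun t => (Real.sinh (c * t) / c, Real.cosh (c * t)) with hg
  -- derivative of `u` within `[t, ∞)` for `t ≥ 0`
  have hP : ∀ t, HasDerivAt (fun r => ∫ s in (0 : ℝ)..r, radialSolDeriv w s) (radialSolDeriv w t) t :=
    fun t => intervalIntegral.integral_hasDerivAt_right (hu'cont.intervalIntegrable 0 t)
      (hu'cont.stronglyMeasurableAtFilter _ _) hu'cont.continuousAt
  have hu' : ∀ t, 0 ≤ t → HasDerivWithinAt (radialSol w) (radialSolDeriv w t) (Ici t) t := by
    intro t ht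
    refine ((hP t).hasDerivWithinAt).congr (fun s hs => ?_) ?_
    · exact radialSol_eq_intervalIntegral_deriv hw hwM hK0 (ht.trans hs)
    · exact radialSol_eq_intervalIntegral_deriv hw hwM hK0 ht
  -- derivative of `u'`: `u'(r) = 1 + ∫₀^r G`, and `G = (K/2) u` on `(-∞, R]`
  have hGeq : ∀ s, s ≤ R → (w s).toReal / 2 * radialSol w s = K / 2 * radialSol w s := by
    intro s hs
    rw [hw_def, squareWell_toReal_of_le hK0 hs]
  have hu'' : ∀ t, t < R →
      HasDerivAt (radialSolDeriv w) (K / 2 * radialSol w t) t := by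
    intro t ht
    have hGc : Continuous fun s => K / 2 * radialSol w s := continuous_const.mul hucont
    have h1 : HasDerivAt (fun r => 1 + ∫ s in (0 : ℝ)..r, K / 2 * radialSol w s)
        (K / 2 * radialSol w t) t := by
      have := intervalIntegral.integral_hasDerivAt_right (hGc.intervalIntegrable 0 t)
        (hGc.stronglyMeasurableAtFilter _ _) hGc.continuousAt
      simpa using this.const_add 1
    refine h1.congr_of_eventuallyEq ?_
    filter_upwards [Iio_mem_nhds ht] with r hr
    rw [radialSolDeriv_eq_intervalIntegral hw hwM hK0 r]
    congr 1
    refine intervalIntegral.integral_congr fun s hs => ?_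
    -- `s` between `0` and `r < R`, so `s ≤ R`
    have hsR : s ≤ R := by
      rcases le_or_gt 0 r with h0r | h0r
      · rw [uIcc_of_le h0r] at hs; exact hs.2.trans hr.le
      · rw [uIcc_of_ge h0r.le] at hs; linarith [hs.2, hr]
    exact hGeq s hsR
  -- assemble the hypotheses of the uniqueness theorem on `[0, R]`
  have hfc : ContinuousOn f (Icc 0 R) :=
    (hucont.prodMk hu'cont).continuousOn
  have hf' : ∀ t ∈ Ico (0 : ℝ) R, HasDerivWithinAt f (v t (f t)) (Ici t) t := by
    intro t ht
    have h1 := hu' t ht.1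
    have h2 := (hu'' t ht.2).hasDerivWithinAt (s := Ici t)
    exact h1.prodMk h2
  have hgc : ContinuousOn g (Icc 0 R) := by
    refine Continuous.continuousOn ?_
    exact ((Real.continuous_sinh.comp (continuous_const.mul continuous_id)).div_const _).prodMk
      (Real.continuous_cosh.comp (continuous_const.mul continuous_id))
  have hg' : ∀ t ∈ Ico (0 : ℝ) R, HasDerivWithinAt g (v t (g t)) (Ici t) t := by
    intro t _
    have hlin : HasDerivAt (fun s : ℝ => c * s) c t := by
      simpa using (hasDerivAt_id t).const_mul c
    have h1 : HasDerivAt (fun s => Real.sinh (c * s) / c) (Real.cosh (c * t) * c / c) t :=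
      ((Real.hasDerivAt_sinh (c * t)).comp t hlin).div_const c
    have h2 : HasDerivAt (fun s => Real.cosh (c * s)) (Real.sinh (c * t) * c) t :=
      (Real.hasDerivAt_cosh (c * t)).comp t hlin
    have h1' : HasDerivAt (fun s => Real.sinh (c * s) / c) (Real.cosh (c * t)) t := by
      convert h1 using 1; field_simp
    have h2' : HasDerivAt (fun s => Real.cosh (c * s)) (K / 2 * (Real.sinh (c * t) / c)) t := by
      convert h2 using 1
      rw [← hc2]; field_simp
    exact (h1'.prodMk h2').hasDerivWithinAt
  have h0 : f 0 = g 0 := by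
    simp only [hf, hg, mul_zero, Real.sinh_zero, zero_div, Real.cosh_zero]
    rw [radialSol_of_nonpos w le_rfl, radialSolDeriv_eq hw hwM hK0, Ioc_self, Measure.restrict_empty,
      integral_zero_measure]
    simp
  have hEq := ODE_solution_unique_of_mem_Icc_right (fun t _ => hvL t) hfc hf' (fun _ _ => mem_univ _)
    hgc hg' (fun _ _ => mem_univ _) h0 ⟨hr0, hrR⟩
  simp only [hf, hg, Prod.mk.injEq] at hEq
  exact hEq

/-- `u(r) = sinh(cr)/c` on `[0, R]`. [cite: FournaisEtAl2024, (3.8)] -/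
theorem radialSol_squareWell (hK : 0 < K) (hR : 0 ≤ R) {r : ℝ} (hr0 : 0 ≤ r) (hrR : r ≤ R) :
    radialSol ((Set.Iic R).indicator fun _ : ℝ => ENNReal.ofReal K) r =
      Real.sinh (Real.sqrt (K / 2) * r) / Real.sqrt (K / 2) :=
  (radialSol_radialSolDeriv_squareWell hK hR hr0 hrR).1

/-- `u'(r) = cosh(cr)` on `[0, R]`. [cite: FournaisEtAl2024, (3.8)] -/
theorem radialSolDeriv_squareWell (hK : 0 < K) (hR : 0 ≤ R) {r : ℝ} (hr0 : 0 ≤ r) (hrR : r ≤ R) :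
    radialSolDeriv ((Set.Iic R).indicator fun _ : ℝ => ENNReal.ofReal K) r =
      Real.cosh (Real.sqrt (K / 2) * r) :=
  (radialSol_radialSolDeriv_squareWell hK hR hr0 hrR).2

/-! ### The scattering length of the well -/

/-- **`a_ODE = R - tanh(cR)/c`** for the well, `c = √(K/2)`. [cite: FournaisEtAl2024, (3.9)] -/
theorem odeScatteringLength_squareWell (hK : 0 < K) (hR : 0 ≤ R) :
    odeScatteringLength ((Set.Iic R).indicator fun _ : ℝ => ENNReal.ofReal K) R =
      R - Real.tanh (Real.sqrt (K / 2) * R) / Real.sqrt (K / 2) := by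
  rw [odeScatteringLength, radialSol_squareWell hK hR hR le_rfl,
    radialSolDeriv_squareWell hK hR hR le_rfl, Real.tanh_eq_sinh_div_cosh]
  have hc : Real.cosh (Real.sqrt (K / 2) * R) ≠ 0 := (Real.cosh_pos _).ne'
  field_simp

/-- **The scattering length of the finite spherical well** of height `K > 0` and radius `R > 0`
(potential `½K` in `-Δ + ½w`, i.e. the topic's convention): `a = R - tanh(R√(K/2))/√(K/2)`.
[cite: FournaisEtAl2024, (3.8)–(3.9)] [cite: LSSY2005, App. C, Thm. C.1] -/
theorem scatteringLength_squareWell (hK : 0 < K) (hR : 0 < R) :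
    scatteringLength ((Set.Iic R).indicator fun _ : ℝ => ENNReal.ofReal K) =
      ENNReal.ofReal (R - Real.tanh (Real.sqrt (K / 2) * R) / Real.sqrt (K / 2)) := by
  rw [← odeScatteringLength_squareWell hK hR.le]
  exact scatteringLength_eq_ofReal_odeScatteringLength (measurable_squareWell K R) (squareWell_le K R)
    hK.le hR (fun s hs => squareWell_eq_zero hs)

/-- **`0 ≤ R - a ≤ √(2/K)`** for the well (`tanh ≤ 1`): the bound behind
`a(V) - a(min(V,K)) ≤ 2√2/√K`. [cite: FournaisEtAl2024, Lemma 3.3, (3.9)] -/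
theorem sub_scatteringLength_squareWell_le (hK : 0 < K) (hR : 0 < R) :
    0 ≤ R - (R - Real.tanh (Real.sqrt (K / 2) * R) / Real.sqrt (K / 2)) ∧
      R - (R - Real.tanh (Real.sqrt (K / 2) * R) / Real.sqrt (K / 2)) ≤ Real.sqrt (2 / K) := by
  have hc0 : 0 < Real.sqrt (K / 2) := Real.sqrt_pos.2 (by positivity)
  have ht0 : 0 ≤ Real.tanh (Real.sqrt (K / 2) * R) := by
    rw [Real.tanh_eq_sinh_div_cosh]
    exact div_nonneg (Real.sinh_nonneg_iff.2 (by positivity)) (Real.cosh_pos _).le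
  have ht1 : Real.tanh (Real.sqrt (K / 2) * R) ≤ 1 := (Real.tanh_lt_one _).le
  refine ⟨by simpa using div_nonneg ht0 hc0.le, ?_⟩
  have hinv : Real.sqrt (2 / K) = (Real.sqrt (K / 2))⁻¹ := by
    rw [← Real.sqrt_inv, inv_div]
  rw [sub_sub_cancel, hinv, div_eq_mul_inv]
  exact mul_le_of_le_one_left (inv_nonneg.2 hc0.le) ht1

/-- Consequently **`R - √(2/K) ≤ a ≤ R`** for the well. [cite: FournaisEtAl2024, Lemma 3.3, (3.9)] -/
theorem scatteringLength_squareWell_bounds (hK : 0 < K) (hR : 0 < R) :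
    ENNReal.ofReal (R - Real.sqrt (2 / K)) ≤
        scatteringLength ((Set.Iic R).indicator fun _ : ℝ => ENNReal.ofReal K) ∧
      scatteringLength ((Set.Iic R).indicator fun _ : ℝ => ENNReal.ofReal K) ≤ ENNReal.ofReal R := by
  obtain ⟨h0, h1⟩ := sub_scatteringLength_squareWell_le hK hR
  rw [scatteringLength_squareWell hK hR]
  constructor <;> apply ENNReal.ofReal_le_ofReal <;> linarith

end Well

end Literature.MathematicalPhysics.QuantumManyBody.BoseGas

end
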